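import Literature.Geometry.Lorentzian.CoordWeightedKornGradient
import Literature.Geometry.Lorentzian.CoordVolumeForm
import HarnessLib

/-!
# Uniform equivalence of the metric norms with the ambient norm on compact sets

Topic `Literature/Geometry/Lorentzian`, coordinate tensor calculus `MetricCoord`. Everything here is
PROVED; no definition and no statement of `Prop` type is introduced.

For Riemannian metric components `G` on an open set `V` of a finite-dimensional normed space
`E` and a compact `C ⊆ V`, the pointwise norms of the calculus — `|v|²_G = G(v,v)` on vectors,
`|φ|²_G = φ(♯φ)` on covectors, `Q(A) = tr_G G(A·,A·)` on endomorphisms — are uniformly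
equivalent on `C` to the squared ambient (operator) norms, and the density `√det g` is bounded
above and below by positive constants there. This is the bookkeeping that transfers the
integral estimates of the calculus (`∫ √g |·|²_G dμ`) to the flat Sobolev spaces of
`Literature/Analysis/FunctionSpaces/SobolevDomain.lean` (Rellich compactness, completeness) in
the compactness argument for the coercivity inequality (3.5) of Chruściel–Delay (Mém. SMF 94
(2003), Prop. 3.3).

* `exists_uniform_bounds_of_quadratic` — a continuous family of positive definite quadratic
  forms on a finite-dimensional space, parametrised by a compact set, is uniformly equivalent to
  `‖·‖²`;
* `IsMetricOn.exists_uniform_bounds_metric` — `m‖v‖² ≤ G(v,v) ≤ M‖v‖²` on `C`;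
* `IsMetricOn.exists_uniform_bounds_cometric` — `m‖φ‖² ≤ φ(♯φ) ≤ M‖φ‖²` on `C`
  (`|∇f|²_G = df(♯df)`);
* `IsMetricOn.exists_uniform_bounds_endo` — `m‖A‖² ≤ Q(A) ≤ M‖A‖²` on `C`;
* `IsMetricOn.exists_uniform_bounds_sqrtDetGram` — `0 < s₀ ≤ √det g ≤ S₀` on `C`.

## References

* P. T. Chruściel, E. Delay, Mém. Soc. Math. Fr. 94 (2003), §3 (proof of Prop. 3.1/3.3:
  "Rellich–Kondrakov compactness on a conditionally compact open set"). [ChruscielDelay2003]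
* B. O'Neill, Semi-Riemannian geometry (1983), Ch. 3. [ONeill1983]
-/

noncomputable section

open Set Filter Module Function Metric
open scoped Topology ContDiff

namespace Literature.Geometry.Lorentzian

namespace MetricCoord

variable {E : Type*} [NormedAddCommGroup E] [NormedSpace ℝ E] [FiniteDimensional ℝ E]
  {G : E → E →L[ℝ] E →L[ℝ] ℝ} {V : Set E}

/-! ### The abstract compactness lemma -/

omit [NormedSpace ℝ E] [FiniteDimensional ℝ E] in
/-- **Uniform equivalence of a compact family of positive definite quadratic forms with `‖·‖²`.**
Let `F` be a finite-dimensional real normed space, `C` a compact set of parameters and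
`q : E → F → ℝ` jointly continuous on `C × F`, homogeneous of degree two and positive definite
in the second variable for each parameter in `C`. Then there are `0 < m` and `M` with
`m‖v‖² ≤ q y v ≤ M‖v‖²` for all `y ∈ C`, `v ∈ F` (minimum and maximum over `C × unit sphere`).
[folklore] -/
theorem exists_uniform_bounds_of_quadratic {F : Type*} [NormedAddCommGroup F] [NormedSpace ℝ F]
    [FiniteDimensional ℝ F] {C : Set E} (hC : IsCompact C) (q : E → F → ℝ)
    (hcont : ContinuousOn (uncurry q) (C ×ˢ univ))
    (hhom : ∀ y ∈ C, ∀ (t : ℝ) (v : F), q y (t • v) = t ^ 2 * q y v)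
    (hpos : ∀ y ∈ C, ∀ v : F, v ≠ 0 → 0 < q y v) :
    ∃ m M : ℝ, 0 < m ∧ 0 ≤ M ∧ ∀ y ∈ C, ∀ v : F, m * ‖v‖ ^ 2 ≤ q y v ∧ q y v ≤ M * ‖v‖ ^ 2 := by
  have hq0 : ∀ y ∈ C, q y 0 = 0 := fun y hy ↦ by
    have h := hhom y hy 0 0
    simp only [zero_smul, ne_eq, OfNat.ofNat_ne_zero, not_false_eq_true, zero_pow, zero_mul] at h
    exact h
  set K : Set (E × F) := C ×ˢ sphere (0 : F) 1 with hK
  have hKc : IsCompact K := hC.prod (isCompact_sphere 0 1)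
  have hcontK : ContinuousOn (uncurry q) K := hcont.mono (prod_mono le_rfl (subset_univ _))
  -- reduction of a general `v ≠ 0` to the unit sphere
  have hscale : ∀ y ∈ C, ∀ v : F, v ≠ 0 →
      q y v = ‖v‖ ^ 2 * q y (‖v‖⁻¹ • v) ∧ (y, ‖v‖⁻¹ • v) ∈ K := by
    intro y hy v hv
    have hn : ‖v‖ ≠ 0 := norm_ne_zero_iff.mpr hv
    refine ⟨?_, ⟨hy, ?_⟩⟩
    · have h := hhom y hy ‖v‖ (‖v‖⁻¹ • v)
      rw [smul_smul, mul_inv_cancel₀ hn, one_smul] at h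
      exact h
    · rw [mem_sphere_zero_iff_norm, norm_smul, norm_inv, norm_norm, inv_mul_cancel₀ hn]
  by_cases hKe : K.Nonempty
  · obtain ⟨p₀, hp₀, hmin⟩ := hKc.exists_isMinOn hKe hcontK
    obtain ⟨p₁, hp₁, hmax⟩ := hKc.exists_isMaxOn hKe hcontK
    have hp₀v : p₀.2 ≠ 0 := by
      have h : p₀.2 ∈ sphere (0 : F) 1 := hp₀.2
      rw [mem_sphere_zero_iff_norm] at h
      intro h0; rw [h0, norm_zero] at h; exact zero_ne_one h
    refine ⟨q p₀.1 p₀.2, max (q p₁.1 p₁.2) 0, hpos p₀.1 hp₀.1 p₀.2 hp₀v, le_max_right _ _,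
      fun y hy v ↦ ?_⟩
    by_cases hv : v = 0
    · rw [hv, hq0 y hy, norm_zero]; simp
    · obtain ⟨hqv, hmem⟩ := hscale y hy v hv
      have hlo : q p₀.1 p₀.2 ≤ q y (‖v‖⁻¹ • v) := hmin hmem
      have hhi : q y (‖v‖⁻¹ • v) ≤ max (q p₁.1 p₁.2) 0 := (hmax hmem).trans (le_max_left _ _)
      have hn2 : 0 ≤ ‖v‖ ^ 2 := sq_nonneg _
      rw [hqv]
      constructor
      · calc q p₀.1 p₀.2 * ‖v‖ ^ 2 = ‖v‖ ^ 2 * q p₀.1 p₀.2 := mul_comm _ _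
          _ ≤ ‖v‖ ^ 2 * q y (‖v‖⁻¹ • v) := mul_le_mul_of_nonneg_left hlo hn2
      · calc ‖v‖ ^ 2 * q y (‖v‖⁻¹ • v) ≤ ‖v‖ ^ 2 * max (q p₁.1 p₁.2) 0 :=
              mul_le_mul_of_nonneg_left hhi hn2
          _ = _ := mul_comm _ _
  · -- `K = ∅`: either `C = ∅` (vacuous) or the unit sphere is empty (`F = 0`, so `v = 0`)
    refine ⟨1, 0, one_pos, le_rfl, fun y hy v ↦ ?_⟩
    have hv : v = 0 := by
      by_contra hv
      exact hKe ⟨_, (hscale y hy v hv).2⟩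
    rw [hv, hq0 y hy, norm_zero]; simp

/-! ### The three pointwise norms of the calculus -/

/-- **`m‖v‖² ≤ G(v,v) ≤ M‖v‖²` uniformly on a compact `C ⊆ V`** for Riemannian metric components.
[cite: ONeill1983, Ch. 3, pp. 60–61] -/
theorem IsMetricOn.exists_uniform_bounds_metric (hG : IsMetricOn G V)
    (hpos : ∀ y ∈ V, ∀ v : E, v ≠ 0 → 0 < G y v v) {C : Set E} (hC : IsCompact C) (hCV : C ⊆ V) :
    ∃ m M : ℝ, 0 < m ∧ 0 ≤ M ∧ ∀ y ∈ C, ∀ v : E,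
      m * ‖v‖ ^ 2 ≤ G y v v ∧ G y v v ≤ M * ‖v‖ ^ 2 := by
  refine exists_uniform_bounds_of_quadratic hC (fun y v ↦ G y v v) ?_ ?_ ?_
  · have hGc : ContinuousOn (fun p : E × E ↦ G p.1) (C ×ˢ univ) :=
      (hG.contDiffOn.continuousOn.mono hCV).comp continuousOn_fst fun p hp ↦ hp.1
    exact (hGc.clm_apply continuousOn_snd).clm_apply continuousOn_snd
  · intro y _ t v
    simp only [map_smul, smul_apply, smul_eq_mul]; ring
  · exact fun y hy v hv ↦ hpos y (hCV hy) v hv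

/-- **`m‖φ‖² ≤ φ(♯φ) ≤ M‖φ‖²` uniformly on a compact `C ⊆ V`**: the cometric on covectors
(`|∇f|²_G = df(♯ df)`). [cite: ONeill1983, Ch. 3, p. 85] -/
theorem IsMetricOn.exists_uniform_bounds_cometric [CompleteSpace E] (hG : IsMetricOn G V)
    (hpos : ∀ y ∈ V, ∀ v : E, v ≠ 0 → 0 < G y v v) {C : Set E} (hC : IsCompact C) (hCV : C ⊆ V) :
    ∃ m M : ℝ, 0 < m ∧ 0 ≤ M ∧ ∀ y ∈ C, ∀ φ : E →L[ℝ] ℝ,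
      m * ‖φ‖ ^ 2 ≤ φ (sharpAt G y φ) ∧ φ (sharpAt G y φ) ≤ M * ‖φ‖ ^ 2 := by
  refine exists_uniform_bounds_of_quadratic hC (fun y (φ : E →L[ℝ] ℝ) ↦ φ (sharpAt G y φ)) ?_ ?_ ?_
  · have hSc : ContinuousOn (fun p : E × (E →L[ℝ] ℝ) ↦ sharpAt G p.1) (C ×ˢ univ) :=
      (hG.contDiffOn_sharpAt.continuousOn.mono hCV).comp continuousOn_fst fun p hp ↦ hp.1
    exact continuousOn_snd.clm_apply (hSc.clm_apply continuousOn_snd)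
  · intro y _ t φ
    simp only [map_smul, smul_apply, smul_eq_mul]; ring
  · intro y hy φ hφ
    have hyV := hCV hy
    have hi := hG.isInvertible y hyV
    rw [← apply_sharpAt_apply hi φ]
    refine hpos y hyV _ fun h0 ↦ hφ ?_
    have h := apply_sharpAt hi φ
    rw [h0, map_zero] at h
    exact h.symm

/-- **`m‖A‖² ≤ Q(A) ≤ M‖A‖²` uniformly on a compact `C ⊆ V`** for the quadratic form
`Q(A) = tr_G G(A·, A·)` on endomorphisms (`|∇Y|² = Q(∇Y)`). [cite: ONeill1983, Ch. 3, pp. 60–61] -/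
theorem IsMetricOn.exists_uniform_bounds_endo {ι : Type*} [Fintype ι] (b : Basis ι ℝ E)
    (hG : IsMetricOn G V)
    (hpos : ∀ y ∈ V, ∀ v : E, v ≠ 0 → 0 < G y v v) {C : Set E} (hC : IsCompact C) (hCV : C ⊆ V) :
    ∃ m M : ℝ, 0 < m ∧ 0 ≤ M ∧ ∀ y ∈ C, ∀ A : E →L[ℝ] E,
      m * ‖A‖ ^ 2 ≤ mtrAt G y ((G y).bilinearComp A A) ∧
        mtrAt G y ((G y).bilinearComp A A) ≤ M * ‖A‖ ^ 2 := by
  refine exists_uniform_bounds_of_quadratic hC (fun y A ↦ mtrAt G y ((G y).bilinearComp A A))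
    ?_ ?_ ?_
  · -- `Q(A) = Σ_{ij} g^{ij} G(A bᵢ, A bⱼ)` is continuous in `(y, A)`
    have heq : (uncurry fun y (A : E →L[ℝ] E) ↦ mtrAt G y ((G y).bilinearComp A A)) =
        fun p : E × (E →L[ℝ] E) ↦ ∑ i, ∑ j, ginv G b p.1 i j * G p.1 (p.2 (b i)) (p.2 (b j)) := by
      funext p
      simp only [uncurry, mtrAt_eq_sum b, ContinuousLinearMap.bilinearComp_apply]
    rw [heq]
    refine continuousOn_finsetSum _ fun i _ ↦ continuousOn_finsetSum _ fun j _ ↦ ?_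
    have hginv : ContinuousOn (fun p : E × (E →L[ℝ] E) ↦ ginv G b p.1 i j) (C ×ˢ univ) :=
      ((hG.contDiffOn_ginv b i j).continuousOn.mono hCV).comp continuousOn_fst fun p hp ↦ hp.1
    have hGc : ContinuousOn (fun p : E × (E →L[ℝ] E) ↦ G p.1) (C ×ˢ univ) :=
      (hG.contDiffOn.continuousOn.mono hCV).comp continuousOn_fst fun p hp ↦ hp.1
    have hAi : ContinuousOn (fun p : E × (E →L[ℝ] E) ↦ p.2 (b i)) (C ×ˢ univ) :=
      continuousOn_snd.clm_apply continuousOn_const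
    have hAj : ContinuousOn (fun p : E × (E →L[ℝ] E) ↦ p.2 (b j)) (C ×ˢ univ) :=
      continuousOn_snd.clm_apply continuousOn_const
    exact hginv.mul ((hGc.clm_apply hAi).clm_apply hAj)
  · intro y _ t A
    rw [mtrAt_eq_sum b, mtrAt_eq_sum b, Finset.mul_sum]
    refine Finset.sum_congr rfl fun i _ ↦ ?_
    rw [Finset.mul_sum]
    refine Finset.sum_congr rfl fun j _ ↦ ?_
    simp only [ContinuousLinearMap.bilinearComp_apply, smul_apply, map_smul,
      smul_eq_mul]
    ring
  · intro y hy A hA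
    have hyV := hCV hy
    -- some `v` with `A v ≠ 0`; then `0 < G(Av,Av) ≤ Q(A) G(v,v)`
    obtain ⟨v, hv⟩ : ∃ v, A v ≠ 0 := by
      by_contra h
      exact hA (ContinuousLinearMap.ext fun v ↦ not_not.mp (not_exists.mp h v))
    have hv0 : v ≠ 0 := fun h0 ↦ hv (by rw [h0, map_zero])
    have h1 : 0 < G y (A v) (A v) := hpos y hyV _ hv
    have h2 := hG.apply_metric_sq_le hyV (hpos y hyV) A v
    have h3 : 0 < G y v v := hpos y hyV v hv0
    by_contra hQ
    have hQ' : mtrAt G y ((G y).bilinearComp A A) ≤ 0 := not_lt.mp hQ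
    have : G y (A v) (A v) ≤ 0 :=
      h2.trans (mul_nonpos_of_nonpos_of_nonneg hQ' h3.le)
    linarith

/-! ### The density -/

omit [FiniteDimensional ℝ E] in
/-- **`0 < s₀ ≤ √det g ≤ S₀` uniformly on a compact `C ⊆ V`** for Riemannian metric components.
[cite: ONeill1983, Ch. 7, Lemma 19] -/
theorem IsMetricOn.exists_uniform_bounds_sqrtDetGram {ι : Type*} [Fintype ι] [DecidableEq ι]
    (b : Basis ι ℝ E) (hG : IsMetricOn G V)
    (hpos : ∀ y ∈ V, ∀ v : E, v ≠ 0 → 0 < G y v v) {C : Set E} (hC : IsCompact C) (hCV : C ⊆ V) :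
    ∃ s₀ S₀ : ℝ, 0 < s₀ ∧ ∀ y ∈ C, s₀ ≤ sqrtDetGram G b y ∧ sqrtDetGram G b y ≤ S₀ := by
  have hcont : ContinuousOn (sqrtDetGram G b) C := (hG.contDiffOn_sqrtDetGram b hpos).continuousOn.mono hCV
  have hposg : ∀ y ∈ C, 0 < sqrtDetGram G b y := fun y hy ↦
    Real.sqrt_pos.mpr (det_gramMatrix_pos b (hG.symm y (hCV hy)) (hpos y (hCV hy)))
  by_cases hCe : C.Nonempty
  · obtain ⟨y₀, hy₀, hmin⟩ := hC.exists_isMinOn hCe hcont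
    obtain ⟨y₁, hy₁, hmax⟩ := hC.exists_isMaxOn hCe hcont
    exact ⟨sqrtDetGram G b y₀, sqrtDetGram G b y₁, hposg y₀ hy₀, fun y hy ↦ ⟨hmin hy, hmax hy⟩⟩
  · exact ⟨1, 1, one_pos, fun y hy ↦ (hCe ⟨y, hy⟩).elim⟩

end MetricCoord

end Literature.Geometry.Lorentzian

end
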